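import Literature.NumberTheory.EllipticCurves.ComplexMultiplicationSingularModuliRows
import Literature.NumberTheory.EllipticCurves.WeierstrassTransformationOdd
import Literature.NumberTheory.EllipticCurves.ComplexMultiplicationJInvariantProofs
import Literature.NumberTheory.EllipticCurves.CMLatticeHomothety
import HarnessLib

/-!
# Singular moduli of the four non-maximal orders of class number one:
# `j(√−3) = 54000`, `j(2i) = 287496`, `j((1+3√−3)/2) = −12288000`, `j(√−7) = 16581375`

Topic `NumberTheory/EllipticCurves`; proofs-only sibling (D-0014 append protocol: no new
definitions, no new named facts) of `ComplexMultiplicationJInvariantProofs.lean`, whose named fact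

* `Literature.NumberTheory.EllipticCurves.singularModuli_nonmaximalOrders` — the rows
  `D = −12, −16, −27, −28` of Cox, *Primes of the form x² + ny²*, §12.C (table (12.20) and the
  table "for the three orders of discriminant divisible by 3", PDF p. 267):
  `j(Λ_D) = 54000, 287496, −12288000, 16581375` for `Λ_D = [ω_D, 1]`, `ω_D = (D + √D)/2` —

is **discharged** here: `singularModuli_nonmaximalOrders_holds`.  It is one of the named leaves
below `Literature.NumberTheory.EllipticCurves.j_mem_cmJInvariants_of_hasCM` ("`E/ℚ` has CM
`⟹ j(E)` is one of the thirteen rational CM `j`-invariants", Silverman *AEC* C.11.3), hence below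
`Literature.NumberTheory.EllipticCurves.finite_point_of_hasCM_of_L_one_ne_zero` (Coates–Wiles for
geometric CM; `ComplexMultiplication.lean`, `ComplexMultiplicationLFunctionTableProofs.lean`);
the corollaries `j_mem_cmJInvariants_of_hasCM_of_facts'` and
`finite_point_of_hasCM_of_L_one_ne_zero_of_lattice_facts'` record the shortened trust base.

## Method (elementary; no `q`-expansions, no integrality of singular moduli)

Cox obtains these values from the integrality of `γ₂(τ₀)`, `j(τ₀)` (Thm. 11.1, Thm. 12.2) and
numerical `q`-expansion estimates ((12.21)–(12.24)), or, for `D = −12`, from the class equation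
(§13.A, `H₋₁₂(X) = X − 54000`); none of this is in Mathlib.  Instead we use that the order of
conductor `f` sits with index `f` in the maximal order, `Λ_{f²d} ⊂ Λ_d` (`indexTwo_cmPeriodPair`,
`indexThree_cmPeriodPair`: `ω_{4d} = 2ω_d + d`, `ω_{9d} = 3ω_d + 3d`), that the singular moduli of
the maximal orders `d = −3, −4, −7` are PROVED in the tree (`j_cmPeriodPair_neg_three/four/seven`:
`g₂(Λ₋₃) = 0`, `g₃(Λ₋₄) = 0`, `7g₂(Λ₋₇)³ = 125g₃(Λ₋₇)²`), and the transformation formulas of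
order two and three for `g₂, g₃` (Lawden, *Elliptic Functions and Applications*, §9.8,
(9.8.12)–(9.8.14); `PeriodPair.g₂_of_indexTwo`, `g₃_of_indexTwo`, `G_four_of_indexThree` of
`WeierstrassTransformation.lean`) together with the division relation satisfied by `e = ℘_Λ(w)`
at the generator `w` of `Λ'/Λ`: for index two `4e³ − g₂e − g₃ = 0`
(`PeriodPair.cubic_weierstrassP_halfPeriod_eq_zero`), for index three the `3`-division relation
`e⁴ − (g₂/2)e² − g₃e − g₂²/48 = 0` (`PeriodPair.quartic_weierstrassP_thirdPeriod_eq_zero`, proved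
here as the `z⁶`-Taylor coefficient at `0` of the third-order transformation
`℘_{Λ'} = ℘ + ℘(· − w) + ℘(· + w) − 2e`, with `G₈ = 3G₄²/7`).  Writing `Λ = Λ_D ⊂ Λ' = Λ_{d}`:

* `D = −12` (`Λ' = Λ₋₃`, index `2`): `0 = g₂' = 60e² − 4g₂`, so `g₂ = 15e²`, `g₃ = 4e³ − g₂e = −11e³`,
  `j = 1728·15³/(15³ − 27·11²) = 1728·3375/108 = 54000`;
* `D = −16` (`Λ' = Λ₋₄`): `0 = g₃' = 56e³ + 8g₃`, so `g₃ = −7e³`, `e(11e² − g₂) = 0`; `e ≠ 0` (below),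
  `j = 1728·11³/(11³ − 27·7²) = 1728·1331/8 = 287496`;
* `D = −28` (`Λ' = Λ₋₇`): `7(60e² − 4g₂)³ = 125(56e³ + 8g₃)²` with `g₃ = 4e³ − g₂e` factors as
  `(7g₂ − 85e²)(g₂² − 15g₂e² + 100e⁴) = 0`; the second factor would give `j(Λ) = −3375 = j(Λ₋₇)`
  (excluded below), so `g₂ = (85/7)e²`, `g₃ = −(57/7)e³`, `j = 1728·85³/(85³ − 27·7·57²) = 16581375`;
* `D = −27` (`Λ' = Λ₋₃`, index `3`): `0 = G₄' = 2e² − 9G₄` and the `3`-division relation give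
  `e ≠ 0` (below), `G₄ = (2/9)e²`, `G₆ = −(253/3780)e³`, `j = −12288000`.

The degenerate alternatives (`e = 0` for `D = −16, −27`; the spurious quadratic factor for
`D = −28`) all force `j(Λ_D) = j(Λ_d)`, hence `Λ_d = cΛ_D` (Cox, Thm. 10.9, the tree's
`PeriodPair.exists_lattice_eq_mulLeft_of_j_eq`), so the multiplier `ω_d` of `Λ_d = ℤ[ω_d]` would
multiply `Λ_D ∋ 1`, i.e. `ω_d ∈ Λ_D` — false (`cmGen_mem_of_j_eq`).  These are exactly the
classical facts "`j(𝒪) ≠ j(𝒪_K)` for `𝒪 ≠ 𝒪_K`" (different multiplier rings, Cox Cor. 10.20).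

| source item | Lean declaration | status |
|---|---|---|
| Cox §12.C, `3 ∣ D` table row `−12` (`j(√−3) = 54000`; §13.A) | `j_cmPeriodPair_neg_twelve` | proved |
| Cox §12.C table (12.20) row `−16` (`j(2i) = 66³`) | `j_cmPeriodPair_neg_sixteen` | proved |
| Cox §12.C, `3 ∣ D` table row `−27` (`j((1+3√−3)/2) = −2¹⁵·3·5³`) | `j_cmPeriodPair_neg_twentyseven` | proved |
| Cox §12.C table (12.20) row `−28` (`j(√−7) = 255³`) | `j_cmPeriodPair_neg_twentyeight` | proved |
| the named fact `singularModuli_nonmaximalOrders` | `singularModuli_nonmaximalOrders_holds` | discharged |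
| `3`-division relation at a third-period (Lawden §9.8, order `3`) | `PeriodPair.quartic_weierstrassP_thirdPeriod_eq_zero` | proved |

## References

* D. A. Cox, *Primes of the form x² + ny²*, 2nd ed., Wiley 2013: Thm. 10.9, Cor. 10.20, §10.C
  (10.21)–(10.22); §12.C table (12.20) and the table for `3 ∣ D` (PDF pp. 266–267); §13.A
  (`H₋₁₂(X) = X − 54000`). [Cox2013]
* D. F. Lawden, *Elliptic Functions and Applications*, Springer 1989, §9.8 (transformations of
  orders two and three, (9.8.6)–(9.8.14)), §6.7 (`℘'² = 4℘³ − g₂℘ − g₃`). [Lawden1989]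
* J. H. Silverman, *The Arithmetic of Elliptic Curves*, 2nd ed. (2009), App. C §11, Examples
  11.3.1–11.3.2 (the four non-maximal rational CM `j`-invariants). [SilvermanAEC2009]

## Mathlib / tree search

Mathlib (pin v4.32.0): `PeriodPair`, `℘`, `PeriodPair.G`, `g₂ = 60G₄`, `g₃ = 140G₆`,
`iteratedDeriv_weierstrassPExcept_self`, `derivWeierstrassP_sq`; no `j` of a lattice, no singular
moduli (`lean search 'singularModul'`, `'cmPeriodPair (-12)'`: only the named fact).  Tree:
`cmGen`, `cmPeriodPair`, `mem_cmPeriodPair_lattice`, `j_cmPeriodPair_neg_three/four/seven`,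
`PeriodPair.j`, `j_def`, `discr_ne_zero`, `exists_lattice_eq_mulLeft_of_j_eq`,
`mul_mem_lattice_of_lattice_eq_mulLeft`, `g₂_of_indexTwo`, `g₃_of_indexTwo`,
`cubic_weierstrassP_halfPeriod_eq_zero`, `two_mul_w_mem_of_indexTwo`, `weierstrassP_of_indexThree`,
`G_four_of_indexThree`, `iteratedDeriv_weierstrassPExcept_sub_of_transformation`,
`iteratedDeriv_6_weierstrassP_eq`, `P3`, `G_eight`; nothing is restated.
-/

noncomputable section

open scoped Topology
open Filter Set Complex

namespace PeriodPair

section ThirdPeriod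

variable {L L' : PeriodPair} {w : ℂ}

/-- **The `3`-division relation at a third-period.**  Let `Λ ⊂ Λ' = Λ ∪ (w + Λ) ∪ (−w + Λ)` with
`w, 2w ∉ Λ` (so `3w ∈ Λ`: `w` is a point of exact order `3` of `ℂ/Λ`), and `e = ℘_Λ(w)`.  Then
`e⁴ − 30G₄e² − 140G₆e − 75G₄² = 0`, i.e. `48e⁴ − 24g₂e² − 48g₃e − g₂² = 0`: `e` is a root of the
`3`-division polynomial `ψ₃ = 3x⁴ − (3/2)g₂x² − 3g₃x − g₂²/16` of `y² = 4x³ − g₂x − g₃`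
(equivalently `℘(2w) = ℘(w)` in the duplication formula).  Proof: compare the `z⁶`-Taylor
coefficients at `0` of the two sides of the third-order transformation
`℘_{Λ'}(z) = ℘(z) + ℘(z − w) + ℘(z + w) − 2e` (`PeriodPair.weierstrassP_of_indexThree`, Lawden
§9.8 (9.8.14)): `7!·(G₈(Λ') − G₈(Λ)) = 2℘⁽⁶⁾(w)` with `℘⁽⁶⁾ = P₃(℘)`, `G₈ = 3G₄²/7` and
`G₄(Λ') = 2e² − 9G₄(Λ)` (`PeriodPair.G_four_of_indexThree`).  Lawden, *Elliptic Functions and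
Applications*, §9.8; Silverman, *AEC*, Exercise 3.7 (division polynomials). [folklore] -/
theorem quartic_weierstrassP_thirdPeriod_eq_zero
    (hΛ : ∀ x, x ∈ L'.lattice ↔ x ∈ L.lattice ∨ x - w ∈ L.lattice ∨ x + w ∈ L.lattice)
    (hw : w ∉ L.lattice) (h2w : 2 * w ∉ L.lattice) :
    ℘[L] w ^ 4 - 30 * L.G 4 * ℘[L] w ^ 2 - 140 * L.G 6 * ℘[L] w - 75 * L.G 4 ^ 2 = 0 := by
  have hnw : -w ∉ L.lattice := fun h ↦ hw (by simpa using neg_mem h)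
  have hw0 : w ≠ 0 := by
    rintro rfl
    exact hw (zero_mem _)
  have hwnw : w ∉ ({-w} : Finset ℂ) := by
    rw [Finset.mem_singleton]
    intro h
    apply h2w
    rw [show 2 * w = 0 by linear_combination h]
    exact zero_mem _
  have h0w : (0 : ℂ) ∉ ({w, -w} : Finset ℂ) := by
    simp only [Finset.mem_insert, Finset.mem_singleton, not_or]
    exact ⟨fun h ↦ hw0 h.symm, fun h ↦ hw0 (neg_eq_zero.mp h.symm)⟩
  have hS0 : (0 : ℂ) ∈ ({0, w, -w} : Finset ℂ) := Finset.mem_insert_self _ _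
  have hSerase : ({0, w, -w} : Finset ℂ).erase 0 = {w, -w} := Finset.erase_insert h0w
  have hS : ∀ c ∈ ({0, w, -w} : Finset ℂ).erase 0, c ∉ L.lattice := by
    intro c hc
    rw [hSerase, Finset.mem_insert, Finset.mem_singleton] at hc
    rcases hc with rfl | rfl
    · exact hw
    · exact hnw
  have hT : ∀ z, z ∉ L'.lattice →
      ℘[L'] z = ∑ c ∈ ({0, w, -w} : Finset ℂ), ℘[L] (z - c) - 2 * ℘[L] w := by
    intro z hz
    rw [weierstrassP_of_indexThree hΛ hw h2w hz, Finset.sum_insert h0w, Finset.sum_insert hwnw,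
      Finset.sum_singleton, sub_zero, sub_neg_eq_add]
    ring
  have h := iteratedDeriv_weierstrassPExcept_sub_of_transformation hS0 hS hT (n := 6)
    (by norm_num)
  rw [L'.iteratedDeriv_weierstrassPExcept_self, L.iteratedDeriv_weierstrassPExcept_self,
    if_neg (by norm_num), if_neg (by norm_num), sumInvPow_zero, sumInvPow_zero, hSerase,
    Finset.sum_insert hwnw, Finset.sum_singleton, neg_neg, L.iteratedDeriv_6_weierstrassP_eq hnw,
    L.iteratedDeriv_6_weierstrassP_eq hw, L.weierstrassP_neg] at h
  simp only [Nat.reduceAdd, Nat.factorial, Nat.succ_eq_add_one, Nat.reduceMul, Nat.cast_ofNat,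
    P3, polyFun, pc3, Finset.sum_range_succ, Finset.sum_range_zero, g₂, g₃] at h
  rw [L'.G_eight, L.G_eight, G_four_of_indexThree hΛ hw h2w] at h
  linear_combination (-1 / 1440 : ℂ) * h

end ThirdPeriod

end PeriodPair

namespace Literature.NumberTheory.EllipticCurves

open PeriodPair

/-! ### The orders of conductor `2` and `3`: `ω_{4d} = 2ω_d + d`, `ω_{9d} = 3ω_d + 3d` -/

/-- `ω_{4d} = 2ω_d + d`: `(4d + √(4d))/2 = 2·(d + √d)/2 + d` (`√(4|d|) = 2√|d|`). [folklore] -/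
lemma cmGen_four_mul {d D : ℤ} (hD : D = 4 * d) : cmGen D = 2 * cmGen d + d := by
  subst hD
  have hs : Real.sqrt (-((4 * d : ℤ) : ℝ)) = 2 * Real.sqrt (-(d : ℝ)) := by
    have h4 : (-((4 * d : ℤ) : ℝ)) = 2 ^ 2 * (-(d : ℝ)) := by push_cast; ring
    rw [h4, Real.sqrt_mul (by positivity), Real.sqrt_sq (by norm_num)]
  simp only [cmGen, hs]
  push_cast
  ring

/-- `ω_{9d} = 3ω_d + 3d`: `(9d + √(9d))/2 = 3·(d + √d)/2 + 3d` (`√(9|d|) = 3√|d|`). [folklore] -/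
lemma cmGen_nine_mul {d D : ℤ} (hD : D = 9 * d) : cmGen D = 3 * cmGen d + 3 * d := by
  subst hD
  have hs : Real.sqrt (-((9 * d : ℤ) : ℝ)) = 3 * Real.sqrt (-(d : ℝ)) := by
    have h9 : (-((9 * d : ℤ) : ℝ)) = 3 ^ 2 * (-(d : ℝ)) := by push_cast; ring
    rw [h9, Real.sqrt_mul (by positivity), Real.sqrt_sq (by norm_num)]
  simp only [cmGen, hs]
  push_cast
  ring

/-- **The order of conductor `2` has index `2` in `ℤ[ω_d]`**: `Λ_d = Λ_{4d} ∪ (ω_d + Λ_{4d})`,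
i.e. `x ∈ Λ_d ↔ x ∈ Λ_{4d} ∨ x − ω_d ∈ Λ_{4d}` (`Λ_D = ℤω_D + ℤ`, `ω_{4d} = 2ω_d + d`;
Cox, Lemma 7.2: `𝒪 = [1, fw_K]`). [folklore] -/
theorem indexTwo_cmPeriodPair {d D : ℤ} (hd : d < 0) (hD : D = 4 * d) (x : ℂ) :
    x ∈ (cmPeriodPair d).lattice ↔
      x ∈ (cmPeriodPair D).lattice ∨ x - cmGen d ∈ (cmPeriodPair D).lattice := by
  have hD0 : D < 0 := by rw [hD]; linarith
  simp only [mem_cmPeriodPair_lattice hd, mem_cmPeriodPair_lattice hD0, cmGen_four_mul hD]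
  constructor
  · rintro ⟨m, n, rfl⟩
    rcases Int.even_or_odd' m with ⟨k, rfl | rfl⟩
    · left
      exact ⟨k, n - k * d, by push_cast; ring⟩
    · right
      exact ⟨k, n - k * d, by push_cast; ring⟩
  · rintro (⟨m, n, h⟩ | ⟨m, n, h⟩)
    · exact ⟨2 * m, n + m * d, by rw [← h]; push_cast; ring⟩
    · exact ⟨2 * m + 1, n + m * d, by push_cast; linear_combination h⟩

/-- **The order of conductor `3` has index `3` in `ℤ[ω_d]`**:
`Λ_d = Λ_{9d} ∪ (ω_d + Λ_{9d}) ∪ (−ω_d + Λ_{9d})` (`ω_{9d} = 3ω_d + 3d`; Cox, Lemma 7.2).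
[folklore] -/
theorem indexThree_cmPeriodPair {d D : ℤ} (hd : d < 0) (hD : D = 9 * d) (x : ℂ) :
    x ∈ (cmPeriodPair d).lattice ↔
      x ∈ (cmPeriodPair D).lattice ∨ x - cmGen d ∈ (cmPeriodPair D).lattice ∨
        x + cmGen d ∈ (cmPeriodPair D).lattice := by
  have hD0 : D < 0 := by rw [hD]; linarith
  simp only [mem_cmPeriodPair_lattice hd, mem_cmPeriodPair_lattice hD0, cmGen_nine_mul hD]
  constructor
  · rintro ⟨m, n, rfl⟩
    obtain ⟨r, hr, k, rfl⟩ : ∃ r : ℤ, (r = 0 ∨ r = 1 ∨ r = 2) ∧ ∃ k : ℤ, m = 3 * k + r :=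
      ⟨m % 3, by omega, m / 3, by omega⟩
    rcases hr with rfl | rfl | rfl
    · left
      exact ⟨k, n - 3 * k * d, by push_cast; ring⟩
    · right; left
      exact ⟨k, n - 3 * k * d, by push_cast; ring⟩
    · right; right
      exact ⟨k + 1, n - 3 * (k + 1) * d, by push_cast; ring⟩
  · rintro (⟨m, n, h⟩ | ⟨m, n, h⟩ | ⟨m, n, h⟩)
    · exact ⟨3 * m, n + 3 * m * d, by rw [← h]; push_cast; ring⟩
    · exact ⟨3 * m + 1, n + 3 * m * d, by push_cast; linear_combination h⟩
    · exact ⟨3 * m - 1, n + 3 * m * d, by push_cast; linear_combination h⟩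

/-- `Λ_d = ℤ[ω_d]` is a ring: `ω_d Λ_d ⊆ Λ_d` (`ω_d² = dω_d − c`, `4c = d(d − 1)`; Cox (7.1),
Lemma 7.2). [folklore] -/
lemma cmGen_mul_mem_cmPeriodPair {d c : ℤ} (hd : d < 0) (hc : d * (d - 1) = 4 * c) {x : ℂ}
    (hx : x ∈ (cmPeriodPair d).lattice) : cmGen d * x ∈ (cmPeriodPair d).lattice := by
  rw [mem_cmPeriodPair_lattice hd] at hx ⊢
  obtain ⟨m, n, rfl⟩ := hx
  have hsq := cmGen_sq hd.le hc
  exact ⟨m * d + n, -(m * c), by push_cast; linear_combination (-(m : ℂ)) * hsq⟩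

/-- **Different multiplier rings have different `j`** (the mechanism of Cox, Cor. 10.20 /
Thm. 10.14): if a lattice `Λ ∋ 1` has `j(Λ) = j(Λ_d)` then `ω_d ∈ Λ` — for `Λ_d = cΛ` by Cox's
Thm. 10.9 (`PeriodPair.exists_lattice_eq_mulLeft_of_j_eq`), so the multiplier `ω_d` of
`Λ_d = ℤ[ω_d]` also multiplies `Λ` (`PeriodPair.mul_mem_lattice_of_lattice_eq_mulLeft`).
[cite: Cox2013, Thm. 10.9 and Cor. 10.20] -/
lemma cmGen_mem_of_j_eq {d c : ℤ} (hd : d < 0) (hc : d * (d - 1) = 4 * c) {L : PeriodPair}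
    (hj : L.j = (cmPeriodPair d).j) (h1 : (1 : ℂ) ∈ L.lattice) : cmGen d ∈ L.lattice := by
  obtain ⟨a, ha, hL⟩ := PeriodPair.exists_lattice_eq_mulLeft_of_j_eq hj
  have h := PeriodPair.mul_mem_lattice_of_lattice_eq_mulLeft hL
    (fun x hx ↦ cmGen_mul_mem_cmPeriodPair hd hc hx) 1 h1
  simpa using h

/-! ### The generators of `Λ_d/Λ_D` are off `Λ_D` -/

/-- `ω₋₃ ∉ Λ₋₁₂` (`ω₋₃ = ½ω₋₁₂ + 3/2`). [folklore] -/
lemma cmGen_neg_three_notMem_cmPeriodPair_neg_twelve :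
    cmGen (-3) ∉ (cmPeriodPair (-12)).lattice := by
  have hD : (-12 : ℤ) < 0 := by norm_num
  have h : cmGen (-3) = ((1 / 2 : ℚ) : ℂ) * (cmPeriodPair (-12)).ω₁ +
      ((3 / 2 : ℚ) : ℂ) * (cmPeriodPair (-12)).ω₂ := by
    rw [cmPeriodPair_ω₁ hD, cmPeriodPair_ω₂,
      cmGen_four_mul (by norm_num : (-12 : ℤ) = 4 * (-3))]
    push_cast
    ring
  rw [h, PeriodPair.mul_ω₁_add_mul_ω₂_mem_lattice]
  norm_num

/-- `ω₋₄ ∉ Λ₋₁₆` (`ω₋₄ = ½ω₋₁₆ + 2`). [folklore] -/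
lemma cmGen_neg_four_notMem_cmPeriodPair_neg_sixteen :
    cmGen (-4) ∉ (cmPeriodPair (-16)).lattice := by
  have hD : (-16 : ℤ) < 0 := by norm_num
  have h : cmGen (-4) = ((1 / 2 : ℚ) : ℂ) * (cmPeriodPair (-16)).ω₁ +
      ((2 : ℚ) : ℂ) * (cmPeriodPair (-16)).ω₂ := by
    rw [cmPeriodPair_ω₁ hD, cmPeriodPair_ω₂,
      cmGen_four_mul (by norm_num : (-16 : ℤ) = 4 * (-4))]
    push_cast
    ring
  rw [h, PeriodPair.mul_ω₁_add_mul_ω₂_mem_lattice]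
  norm_num

/-- `ω₋₇ ∉ Λ₋₂₈` (`ω₋₇ = ½ω₋₂₈ + 7/2`). [folklore] -/
lemma cmGen_neg_seven_notMem_cmPeriodPair_neg_twentyeight :
    cmGen (-7) ∉ (cmPeriodPair (-28)).lattice := by
  have hD : (-28 : ℤ) < 0 := by norm_num
  have h : cmGen (-7) = ((1 / 2 : ℚ) : ℂ) * (cmPeriodPair (-28)).ω₁ +
      ((7 / 2 : ℚ) : ℂ) * (cmPeriodPair (-28)).ω₂ := by
    rw [cmPeriodPair_ω₁ hD, cmPeriodPair_ω₂,
      cmGen_four_mul (by norm_num : (-28 : ℤ) = 4 * (-7))]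
    push_cast
    ring
  rw [h, PeriodPair.mul_ω₁_add_mul_ω₂_mem_lattice]
  norm_num

/-- `ω₋₃ ∉ Λ₋₂₇` (`ω₋₃ = ⅓ω₋₂₇ + 3`). [folklore] -/
lemma cmGen_neg_three_notMem_cmPeriodPair_neg_twentyseven :
    cmGen (-3) ∉ (cmPeriodPair (-27)).lattice := by
  have hD : (-27 : ℤ) < 0 := by norm_num
  have h : cmGen (-3) = ((1 / 3 : ℚ) : ℂ) * (cmPeriodPair (-27)).ω₁ +
      ((3 : ℚ) : ℂ) * (cmPeriodPair (-27)).ω₂ := by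
    rw [cmPeriodPair_ω₁ hD, cmPeriodPair_ω₂,
      cmGen_nine_mul (by norm_num : (-27 : ℤ) = 9 * (-3))]
    push_cast
    ring
  rw [h, PeriodPair.mul_ω₁_add_mul_ω₂_mem_lattice]
  norm_num

/-- `2ω₋₃ ∉ Λ₋₂₇` (`2ω₋₃ = ⅔ω₋₂₇ + 6`). [folklore] -/
lemma two_mul_cmGen_neg_three_notMem_cmPeriodPair_neg_twentyseven :
    2 * cmGen (-3) ∉ (cmPeriodPair (-27)).lattice := by
  have hD : (-27 : ℤ) < 0 := by norm_num
  have h : 2 * cmGen (-3) = ((2 / 3 : ℚ) : ℂ) * (cmPeriodPair (-27)).ω₁ +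
      ((6 : ℚ) : ℂ) * (cmPeriodPair (-27)).ω₂ := by
    rw [cmPeriodPair_ω₁ hD, cmPeriodPair_ω₂,
      cmGen_nine_mul (by norm_num : (-27 : ℤ) = 9 * (-3))]
    push_cast
    ring
  rw [h, PeriodPair.mul_ω₁_add_mul_ω₂_mem_lattice]
  norm_num

/-! ### The invariants of the three maximal lattices used -/

/-- `g₂(Λ₋₃) = 0` (`j(Λ₋₃) = 0`, `j_cmPeriodPair_neg_three`). [folklore] -/
lemma g₂_cmPeriodPair_neg_three : (cmPeriodPair (-3)).g₂ = 0 := by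
  have h := j_cmPeriodPair_neg_three
  rw [PeriodPair.j_def, div_eq_iff (cmPeriodPair (-3)).discr_ne_zero] at h
  have h3 : (cmPeriodPair (-3)).g₂ ^ 3 = 0 := by linear_combination h / 1728
  exact (pow_eq_zero_iff (by norm_num)).mp h3

/-- `G₄(Λ₋₃) = 0`. [folklore] -/
lemma G_four_cmPeriodPair_neg_three : (cmPeriodPair (-3)).G 4 = 0 := by
  have h := g₂_cmPeriodPair_neg_three
  simp only [PeriodPair.g₂] at h
  linear_combination h / 60

/-- `g₃(Λ₋₄) = 0` (`j(Λ₋₄) = 1728`, `j_cmPeriodPair_neg_four`). [folklore] -/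
lemma g₃_cmPeriodPair_neg_four : (cmPeriodPair (-4)).g₃ = 0 := by
  have h := j_cmPeriodPair_neg_four
  rw [PeriodPair.j_def, div_eq_iff (cmPeriodPair (-4)).discr_ne_zero] at h
  have h2 : (cmPeriodPair (-4)).g₃ ^ 2 = 0 := by linear_combination h / 46656
  exact (pow_eq_zero_iff (by norm_num)).mp h2

/-- `7g₂(Λ₋₇)³ = 125g₃(Λ₋₇)²` (`j(Λ₋₇) = −3375 = −1728·125/64`, `j_cmPeriodPair_neg_seven`).
[folklore] -/
lemma seven_mul_g₂_cube_cmPeriodPair_neg_seven :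
    7 * (cmPeriodPair (-7)).g₂ ^ 3 = 125 * (cmPeriodPair (-7)).g₃ ^ 2 := by
  have h := j_cmPeriodPair_neg_seven
  rw [PeriodPair.j_def, div_eq_iff (cmPeriodPair (-7)).discr_ne_zero] at h
  linear_combination h / 729

/-! ### Row `D = −12`: `j(√−3) = 54000` -/

/-- **Row `D = −12`: `j(ℤ[√−3]) = j(√−3) = 54000 = 2⁴·3³·5³`** (Cox, §12.C, the table for
`3 ∣ D`; §13.A: `H₋₁₂(X) = X − 54000`).  Proof: `Λ₋₃ = Λ₋₁₂ ∪ (ω₋₃ + Λ₋₁₂)`; with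
`e = ℘_{Λ₋₁₂}(ω₋₃)`, Lawden (9.8.12) gives `0 = g₂(Λ₋₃) = 60e² − 4g₂`, the half-period relation
gives `g₃ = 4e³ − g₂e = −11e³`, and `j = 1728·15³/(15³ − 27·11²) = 54000`.
[cite: Cox2013, §12.C table for 3 ∣ D, row D = -12 (PDF p. 267), and §13.A] -/
theorem j_cmPeriodPair_neg_twelve : (cmPeriodPair (-12)).j = 54000 := by
  have hd : (-3 : ℤ) < 0 := by norm_num
  have hΛ := indexTwo_cmPeriodPair hd (by norm_num : (-12 : ℤ) = 4 * (-3))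
  have hw := cmGen_neg_three_notMem_cmPeriodPair_neg_twelve
  have h2 := PeriodPair.g₂_of_indexTwo hΛ hw
  have hc := PeriodPair.cubic_weierstrassP_halfPeriod_eq_zero hw
    (PeriodPair.two_mul_w_mem_of_indexTwo hΛ hw)
  rw [g₂_cmPeriodPair_neg_three] at h2
  set e := ℘[cmPeriodPair (-12)] (cmGen (-3)) with he
  have hA : (cmPeriodPair (-12)).g₂ = 15 * e ^ 2 := by linear_combination h2 / 4
  have hB : (cmPeriodPair (-12)).g₃ = -11 * e ^ 3 := by linear_combination -hc - e * hA
  rw [PeriodPair.j_def, div_eq_iff (cmPeriodPair (-12)).discr_ne_zero, hA, hB]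
  ring

/-! ### Row `D = −16`: `j(2i) = 287496` -/

/-- **Row `D = −16`: `j(ℤ[2i]) = j(2i) = 287496 = 66³`** (Cox, §12.C table (12.20), row `−16`).
Proof: `Λ₋₄ = Λ₋₁₆ ∪ (ω₋₄ + Λ₋₁₆)`; with `e = ℘_{Λ₋₁₆}(ω₋₄)`, Lawden (9.8.13) gives
`0 = g₃(Λ₋₄) = 56e³ + 8g₃`, the half-period relation gives `e(11e² − g₂) = 0`, and `e ≠ 0` (else
`g₃ = 0`, `j(Λ₋₁₆) = 1728 = j(Λ₋₄)` and `ω₋₄ = i − 2` would lie in `Λ₋₁₆ = ℤ·2i + ℤ`,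
`cmGen_mem_of_j_eq`); so `j = 1728·11³/(11³ − 27·7²) = 287496`.
[cite: Cox2013, §12.C table (12.20), row d = -16 (PDF pp. 266–267)] -/
theorem j_cmPeriodPair_neg_sixteen : (cmPeriodPair (-16)).j = 287496 := by
  have hd : (-4 : ℤ) < 0 := by norm_num
  have hΛ := indexTwo_cmPeriodPair hd (by norm_num : (-16 : ℤ) = 4 * (-4))
  have hw := cmGen_neg_four_notMem_cmPeriodPair_neg_sixteen
  have h3 := PeriodPair.g₃_of_indexTwo hΛ hw
  have hc := PeriodPair.cubic_weierstrassP_halfPeriod_eq_zero hw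
    (PeriodPair.two_mul_w_mem_of_indexTwo hΛ hw)
  rw [g₃_cmPeriodPair_neg_four] at h3
  set e := ℘[cmPeriodPair (-16)] (cmGen (-4)) with he
  have hB : (cmPeriodPair (-16)).g₃ = -7 * e ^ 3 := by linear_combination -h3 / 8
  have he0 : e ≠ 0 := by
    intro he0
    have hg₃ : (cmPeriodPair (-16)).g₃ = 0 := by rw [hB, he0]; ring
    have hj : (cmPeriodPair (-16)).j = (cmPeriodPair (-4)).j := by
      rw [j_cmPeriodPair_neg_four, PeriodPair.j_def, div_eq_iff (cmPeriodPair (-16)).discr_ne_zero,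
        hg₃]
      ring
    exact hw (cmGen_mem_of_j_eq hd (c := 5) (by norm_num) hj (cmPeriodPair (-16)).ω₂_mem_lattice)
  have hA : (cmPeriodPair (-16)).g₂ = 11 * e ^ 2 := by
    have h : e * ((cmPeriodPair (-16)).g₂ - 11 * e ^ 2) = 0 := by linear_combination -hc - hB
    rcases mul_eq_zero.mp h with h | h
    · exact absurd h he0
    · linear_combination h
  rw [PeriodPair.j_def, div_eq_iff (cmPeriodPair (-16)).discr_ne_zero, hA, hB]
  ring

/-! ### Row `D = −28`: `j(√−7) = 16581375` -/

/-- **Row `D = −28`: `j(ℤ[√−7]) = j(√−7) = 16581375 = 255³`** (Cox, §12.C table (12.20), row `−28`).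
Proof: `Λ₋₇ = Λ₋₂₈ ∪ (ω₋₇ + Λ₋₂₈)`; with `e = ℘_{Λ₋₂₈}(ω₋₇)`, Lawden (9.8.12)–(9.8.13) and the
proved row `d = −7` (`7g₂(Λ₋₇)³ = 125g₃(Λ₋₇)²`) give `7(60e² − 4g₂)³ = 125(56e³ + 8g₃)²`, and with
the half-period relation `g₃ = 4e³ − g₂e` this factors as
`(7g₂ − 85e²)(g₂² − 15g₂e² + 100e⁴) = 0`.  The second factor would force `j(Λ₋₂₈) = −3375 = j(Λ₋₇)`,
whence `ω₋₇ ∈ Λ₋₂₈` (`cmGen_mem_of_j_eq`), which is false; so `g₂ = (85/7)e²`,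
`g₃ = −(57/7)e³` and `j = 1728·85³/(85³ − 27·7·57²) = 16581375`.
[cite: Cox2013, §12.C table (12.20), row d = -28 (PDF pp. 266–267)] -/
theorem j_cmPeriodPair_neg_twentyeight : (cmPeriodPair (-28)).j = 16581375 := by
  have hd : (-7 : ℤ) < 0 := by norm_num
  have hΛ := indexTwo_cmPeriodPair hd (by norm_num : (-28 : ℤ) = 4 * (-7))
  have hw := cmGen_neg_seven_notMem_cmPeriodPair_neg_twentyeight
  have h2 := PeriodPair.g₂_of_indexTwo hΛ hw
  have h3 := PeriodPair.g₃_of_indexTwo hΛ hw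
  have hc := PeriodPair.cubic_weierstrassP_halfPeriod_eq_zero hw
    (PeriodPair.two_mul_w_mem_of_indexTwo hΛ hw)
  have h7 := seven_mul_g₂_cube_cmPeriodPair_neg_seven
  rw [h2, h3] at h7
  set e := ℘[cmPeriodPair (-28)] (cmGen (-7)) with he
  have hB : (cmPeriodPair (-28)).g₃ = 4 * e ^ 3 - (cmPeriodPair (-28)).g₂ * e := by
    linear_combination -hc
  rw [hB] at h7
  have key : (7 * (cmPeriodPair (-28)).g₂ - 85 * e ^ 2) *
      ((cmPeriodPair (-28)).g₂ ^ 2 - 15 * (cmPeriodPair (-28)).g₂ * e ^ 2 + 100 * e ^ 4) = 0 := by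
    linear_combination (-1 / 64 : ℂ) * h7
  rcases mul_eq_zero.mp key with hA | hQ
  · have hA' : (cmPeriodPair (-28)).g₂ = 85 / 7 * e ^ 2 := by linear_combination hA / 7
    rw [PeriodPair.j_def, div_eq_iff (cmPeriodPair (-28)).discr_ne_zero, hB, hA']
    ring
  · exfalso
    have hj : (cmPeriodPair (-28)).j = (cmPeriodPair (-7)).j := by
      rw [j_cmPeriodPair_neg_seven, PeriodPair.j_def,
        div_eq_iff (cmPeriodPair (-28)).discr_ne_zero, hB]
      linear_combination (729 * (7 * (cmPeriodPair (-28)).g₂ - 20 * e ^ 2)) * hQ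
    exact hw (cmGen_mem_of_j_eq hd (c := 14) (by norm_num) hj (cmPeriodPair (-28)).ω₂_mem_lattice)

/-! ### Row `D = −27`: `j((1 + 3√−3)/2) = −12288000` -/

/-- **Row `D = −27`: `j(ℤ[3ω]) = j((1 + 3√−3)/2) = −12288000 = −2¹⁵·3·5³`** (Cox, §12.C, the
table for `3 ∣ D`, row `−27`).  Proof: `Λ₋₃ = Λ₋₂₇ ∪ (ω₋₃ + Λ₋₂₇) ∪ (−ω₋₃ + Λ₋₂₇)` (index `3`);
with `e = ℘_{Λ₋₂₇}(ω₋₃)`, the weight-four transformation formula gives `0 = G₄(Λ₋₃) = 2e² − 9G₄`,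
the `3`-division relation (`PeriodPair.quartic_weierstrassP_thirdPeriod_eq_zero`) then gives
`e(3780G₆ + 253e³) = 0`, and `e ≠ 0` (else `G₄ = 0`, `j(Λ₋₂₇) = 0 = j(Λ₋₃)` and `ω₋₃ ∈ Λ₋₂₇`,
`cmGen_mem_of_j_eq`); so `g₂ = (40/3)e²`, `g₃ = −(253/27)e³`, `27g₂³ = 64000e⁶`,
`27·27g₃² = 64009e⁶`, and `j = 1728·64000/(64000 − 64009) = −12288000`.
[cite: Cox2013, §12.C table for 3 ∣ D, row D = -27 (PDF p. 267)] -/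
theorem j_cmPeriodPair_neg_twentyseven : (cmPeriodPair (-27)).j = -12288000 := by
  have hd : (-3 : ℤ) < 0 := by norm_num
  have hΛ := indexThree_cmPeriodPair hd (by norm_num : (-27 : ℤ) = 9 * (-3))
  have hw := cmGen_neg_three_notMem_cmPeriodPair_neg_twentyseven
  have h2w := two_mul_cmGen_neg_three_notMem_cmPeriodPair_neg_twentyseven
  have h4 := PeriodPair.G_four_of_indexThree hΛ hw h2w
  have hq := PeriodPair.quartic_weierstrassP_thirdPeriod_eq_zero hΛ hw h2w
  rw [G_four_cmPeriodPair_neg_three] at h4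
  set e := ℘[cmPeriodPair (-27)] (cmGen (-3)) with he
  have hA : (cmPeriodPair (-27)).G 4 = 2 / 9 * e ^ 2 := by linear_combination h4 / 9
  have he0 : e ≠ 0 := by
    intro he0
    have hG : (cmPeriodPair (-27)).G 4 = 0 := by rw [hA, he0]; ring
    have hg₂ : (cmPeriodPair (-27)).g₂ = 0 := by simp [PeriodPair.g₂, hG]
    have hj : (cmPeriodPair (-27)).j = (cmPeriodPair (-3)).j := by
      rw [j_cmPeriodPair_neg_three, PeriodPair.j_def, hg₂]
      simp
    exact hw (cmGen_mem_of_j_eq hd (c := 3) (by norm_num) hj (cmPeriodPair (-27)).ω₂_mem_lattice)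
  have hB : (cmPeriodPair (-27)).G 6 = -(253 / 3780) * e ^ 3 := by
    have h : e * ((cmPeriodPair (-27)).G 6 + 253 / 3780 * e ^ 3) = 0 := by
      linear_combination (-1 / 140 : ℂ) * hq +
        (-(1 / 3) * e ^ 2 - 15 / 28 * (cmPeriodPair (-27)).G 4) * hA
    rcases mul_eq_zero.mp h with h | h
    · exact absurd h he0
    · linear_combination h
  rw [PeriodPair.j_def, div_eq_iff (cmPeriodPair (-27)).discr_ne_zero]
  simp only [PeriodPair.g₂, PeriodPair.g₃]
  rw [hA, hB]
  ring

/-! ### The named fact, discharged; shortened trust bases -/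

/-- **`singularModuli_nonmaximalOrders` holds**: the singular moduli of the four non-maximal
orders of class number one are `j(Λ₋₁₂) = 54000`, `j(Λ₋₁₆) = 287496`, `j(Λ₋₂₇) = −12288000`,
`j(Λ₋₂₈) = 16581375` (Cox, §12.C, table (12.20) rows `−16, −28` and the table for `3 ∣ D`,
rows `−12, −27`), proved by the rows above.
[cite: Cox2013, §12.C table (12.20) rows −16, −28 and the table for 3 ∣ D, rows −12, −27] -/
theorem singularModuli_nonmaximalOrders_holds : singularModuli_nonmaximalOrders :=
  ⟨j_cmPeriodPair_neg_twelve, j_cmPeriodPair_neg_sixteen, j_cmPeriodPair_neg_twentyseven,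
    j_cmPeriodPair_neg_twentyeight⟩

/-- **`j_mem_cmJInvariants_of_hasCM` from five named facts** (`j_mem_cmJInvariants_of_hasCM_of_facts`
with the non-maximal singular moduli discharged): the algebraic–analytic bridge
`periodPair_hasCM_of_hasCM` (Silverman *AEC* VI.5.3), the class equation
(`irreducible_classPolynomial`, `isRoot_classPolynomial`, Cox Prop. 13.2), Heegner–Baker–Stark for
orders (`mem_classNumberOneDiscrs_of_classNumber_eq_one`, Cox Thm. 7.30(ii)) and the nine maximal
singular moduli (`singularModuli_classNumberOne`, of which six rows are proved in the tree).
[cite: SilvermanAEC2009, App. C §11, Example 11.3.1–11.3.2] -/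
theorem j_mem_cmJInvariants_of_hasCM_of_facts' (hE : periodPair_hasCM_of_hasCM)
    (hirr : irreducible_classPolynomial) (hroot : isRoot_classPolynomial)
    (hh : Literature.NumberTheory.QuadraticFields.BinaryQuadraticForm.mem_classNumberOneDiscrs_of_classNumber_eq_one)
    (h9 : singularModuli_classNumberOne) : j_mem_cmJInvariants_of_hasCM :=
  j_mem_cmJInvariants_of_hasCM_of_facts hE hirr hroot hh h9 singularModuli_nonmaximalOrders_holds

/-- **`finite_point_of_hasCM_of_L_one_ne_zero` (Coates–Wiles for geometric CM, bsd.S28) from its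
lattice-side leaves**, the non-maximal singular moduli being discharged:
`finite_point_of_hasCM_of_L_one_ne_zero_of_CoatesWiles1977_of_lattice_facts` minus `h4`.
[cite: CoatesWiles1977, Thm 1 (p. 223)] [cite: SilvermanAEC2009, App. C §16, Evidence C.16.5.3] -/
theorem finite_point_of_hasCM_of_L_one_ne_zero_of_lattice_facts'
    (hCW : CoatesWiles1977_L_one_eq_zero_of_not_isOfFinAddOrder)
    (hR2 : LFunction_eq_of_isIsogenous)
    (hT : exists_isIsogenous_j_mem_maximalCMJInvariants_of_j_mem_nonmaximalCMJInvariants)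
    (hE : periodPair_hasCM_of_hasCM) (hirr : irreducible_classPolynomial)
    (hroot : isRoot_classPolynomial)
    (hh : Literature.NumberTheory.QuadraticFields.BinaryQuadraticForm.mem_classNumberOneDiscrs_of_classNumber_eq_one)
    (h9 : singularModuli_classNumberOne) : finite_point_of_hasCM_of_L_one_ne_zero :=
  finite_point_of_hasCM_of_L_one_ne_zero_of_CoatesWiles1977_of_lattice_facts hCW hR2 hT hE hirr
    hroot hh h9 singularModuli_nonmaximalOrders_holds

end Literature.NumberTheory.EllipticCurves

end
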